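import Mathlib
import Literature.Barriers.MatrixMultiplication.NormalizerBarrier
import Literature.RepresentationTheory.FiniteGroups.IrreducibleCharacters
import Literature.RepresentationTheory.FiniteGroups.InducedClassFunction
import Literature.RepresentationTheory.FiniteGroups.MonomialRepresentation
import Summits.MatrixMultiplication.MatrixMultiplication.Theorems.LieRankDesigns.Negative.Basics
import Summits.MatrixMultiplication.MatrixMultiplication.Theorems.SubgroupIdentityDesigns.Negative.GrassmannOrbits
import Summits.MatrixMultiplication.MatrixMultiplication.Theorems.SubgroupIdentityDesigns.Negative.FlagCharacter
import Summits.MatrixMultiplication.MatrixMultiplication.Theorems.SubgroupIdentityDesigns.Negative.FlagTwist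
import Summits.MatrixMultiplication.MatrixMultiplication.Theorems.SubgroupIdentityDesigns.Negative.FlagTwistNorm

/-!
# `⟨Ψ_χ, Ψ_χ'⟩ = 0` unless `χ'` is a rearrangement of `χ` (Mackey by hand, two tuples)

Supports stmt-MatrixMultiplication-14079 (crux `SubgroupIdentityDesigns`, route `LevelGradedCohnUmans`;
BLOCK-SLICES §2).  VALUE = theorem (the principal-series characters `Ψ_χ` are pairwise distinct, so
MANY level-`k` irreducibles enter the budget), NOT summit progress.

For the twisted flag characters `Ψ_χ = Ind_{P'}^G λ_χ` of `FlagTwist` (`P'` the stabiliser of the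
standard flag `⟨e_0⟩ ⊂ … ⊂ ⟨e_0, …, e_{k-1}⟩` in `G = GL_{k+l}(F)`, `λ_χ(s) = ∏_i χ_i(s_{c_i c_i})`):
* `card_mul_classInner`, `card_mul_classInner_eq_sum`, `cosetTerm_eq_sum_fq` — Frobenius reciprocity
  `|P'| ⟨Ψ_χ, Ψ_χ'⟩ = ∑_{s ∈ P'} λ_χ(s)⁻¹ Ψ_χ'(s) = ∑_q T(q)`, the coset term of `q` being the sum over
  the stabiliser `P'_q` of the linear character `f_q(s) = λ_χ'(g_q⁻¹ s g_q) / λ_χ(s)`;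
* `fq_ne_one` — if every `χ'_i ≠ 1` and `χ'` is NOT of the form `χ ∘ σ` (`σ ∈ Sym(k)`), then
  `f_q ≠ 1` for EVERY coset `q`: writing `q = s₀ w(τ) P'` (Bruhat, `exists_perm_orbit`), the torus
  probes `s₀ diag(δ^x_{τ a}) s₀⁻¹ ∈ P'_q` give `λ_χ'(diag δ^x_a) = λ_χ(diag δ^x_{τ a})`; at `a = c_i`
  this forces `τ c_i = c_{σ i}` with `χ'_i = χ_{σ i}` (or `χ'_i = 1`), i.e. `χ' = χ ∘ σ`;
* `cosetTerm_eq_zero`, **`classInner_twChar_twChar : ⟨Ψ_χ, Ψ_χ'⟩ = 0`**, and `twChar_ne`: for `χ`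
  with distinct non-trivial entries (`⟨Ψ_χ, Ψ_χ⟩ = 1`, `FlagTwistNorm`) `Ψ_χ ≠ Ψ_χ'`.
(Standard: the principal-series representations `Ind_B(χ_1 ⊗ ⋯ ⊗ χ_k ⊗ 1^{⊗ l})` of `GL_n(𝔽_q)` for
characters in general position are irreducible and determined by the multiset `{χ_i}`; Bump,
*Lie Groups*, Ch. 46–47; Digne–Michel Ch. 6.)
-/

set_option linter.dupNamespace false

noncomputable section

open scoped BigOperators Matrix Classical
open Literature.RepresentationTheory.FiniteGroups

namespace Summit.MatrixMultiplication.MatrixMultiplication.Theorems.SubgroupIdentityDesigns.Negative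
namespace FlagTwistOrtho

open GrassmannOrbits (permGL)
open FlagCharacter (flagStab exists_perm_orbit)
open FlagTwist (lam lam_conj twChar twChar_apply isClassFun_twChar diagGL diagGL_mem conj_diagGL
  lam_diagGL_mulSingle_castAdd lam_diagGL_mulSingle_of_ne)
open FlagTwistNorm (conjHom classInner_twChar)

variable {F : Type} [Field F] [Fintype F] [DecidableEq F] {k l : ℕ}

/-! ## Frobenius reciprocity and the coset terms -/

/-- **`|P'| ⟨Ψ_χ, Ψ_χ'⟩ = ∑_{s ∈ P'} λ_χ(s)⁻¹ Ψ_χ'(s)`.** -/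
theorem card_mul_classInner (χ χ' : Fin k → MulChar F ℂ) :
    (Fintype.card (flagStab F k l) : ℂ) * classInner (twChar (l := l) χ) (twChar χ') =
      ∑ s : flagStab F k l, ((lam χ s : ℂˣ) : ℂ)⁻¹ * twChar χ' (s : GL (Fin (k + l)) F) := by
  have hP : (Fintype.card (flagStab F k l) : ℂ) ≠ 0 := Nat.cast_ne_zero.mpr Fintype.card_ne_zero
  conv_lhs => rw [twChar, classInner_indClassFun_left _ _ (isClassFun_twChar χ'), classInner_apply]
  rw [← mul_assoc, mul_inv_cancel₀ hP, one_mul]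
  refine Fintype.sum_equiv (Equiv.inv (flagStab F k l)) _ _ fun s => ?_
  simp only [Equiv.inv_apply, inv_inv, map_inv, Units.val_inv_eq_inv_val]

/-- The coset term `T(q) = ∑_{s ∈ P'} λ_χ(s)⁻¹ [s q = q] λ_χ'(g_q⁻¹ s g_q)`. -/
def cosetTerm (χ χ' : Fin k → MulChar F ℂ) (q : GL (Fin (k + l)) F ⧸ flagStab F k l) : ℂ :=
  ∑ s : flagStab F k l, ((lam χ s : ℂˣ) : ℂ)⁻¹ *
    (if h : q.out⁻¹ * (s : GL (Fin (k + l)) F) * q.out ∈ flagStab F k l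
      then ((lam χ' ⟨_, h⟩ : ℂˣ) : ℂ) else 0)

/-- `|P'| ⟨Ψ_χ, Ψ_χ'⟩ = ∑_q T(q)`. -/
theorem card_mul_classInner_eq_sum (χ χ' : Fin k → MulChar F ℂ) :
    (Fintype.card (flagStab F k l) : ℂ) * classInner (twChar (l := l) χ) (twChar χ') =
      ∑ q : GL (Fin (k + l)) F ⧸ flagStab F k l, cosetTerm χ χ' q := by
  rw [card_mul_classInner]
  simp only [cosetTerm, twChar_apply, Finset.mul_sum]
  exact Finset.sum_comm

/-- The linear character `f_q(s) = λ_χ'(g_q⁻¹ s g_q) / λ_χ(s)` of the stabiliser `P'_q`. -/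
def fq (χ χ' : Fin k → MulChar F ℂ) (q : GL (Fin (k + l)) F ⧸ flagStab F k l) :
    MulAction.stabilizer (flagStab F k l) q →* ℂ :=
  (Units.coeHom ℂ).comp (((lam χ').comp (conjHom q)) /
    ((lam χ).comp (MulAction.stabilizer (flagStab F k l) q).subtype))

omit [Fintype F] in
/-- Value of `f_q`. -/
theorem fq_apply (χ χ' : Fin k → MulChar F ℂ) (q : GL (Fin (k + l)) F ⧸ flagStab F k l)
    (h : MulAction.stabilizer (flagStab F k l) q) :
    fq χ χ' q h = ((lam χ (h : flagStab F k l) : ℂˣ) : ℂ)⁻¹ * ((lam χ' (conjHom q h) : ℂˣ) : ℂ) := by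
  show (((lam χ' (conjHom q h) / lam χ (h : flagStab F k l) : ℂˣ)) : ℂ) = _
  rw [div_eq_mul_inv, Units.val_mul, Units.val_inv_eq_inv_val, mul_comm]

/-- `T(q) = ∑_{s ∈ P'_q} f_q(s)`. -/
theorem cosetTerm_eq_sum_fq (χ χ' : Fin k → MulChar F ℂ) (q : GL (Fin (k + l)) F ⧸ flagStab F k l) :
    cosetTerm χ χ' q = ∑ h : MulAction.stabilizer (flagStab F k l) q, fq χ χ' q h := by
  rw [cosetTerm, ← Finset.sum_filter_of_ne
    (p := fun s : flagStab F k l => s ∈ MulAction.stabilizer (flagStab F k l) q)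
    (fun s _ hne => ?_)]
  · rw [Finset.sum_subtype (Finset.univ.filter fun s : flagStab F k l =>
        s ∈ MulAction.stabilizer (flagStab F k l) q)
      (p := fun s : flagStab F k l => s ∈ MulAction.stabilizer (flagStab F k l) q)
      (fun s => by simp)]
    refine Finset.sum_congr rfl fun h _ => ?_
    have hmem : q.out⁻¹ * ((h : flagStab F k l) : GL (Fin (k + l)) F) * q.out ∈ flagStab F k l :=
      (smul_eq_self_iff_mem _ _ q).mp (MulAction.mem_stabilizer_iff.mp h.2)
    rw [dif_pos hmem, fq_apply]
    rfl
  · by_contra hno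
    rw [dif_neg (fun hm => hno (MulAction.mem_stabilizer_iff.mpr
      ((smul_eq_self_iff_mem _ ((s : flagStab F k l) : GL (Fin (k + l)) F) q).mpr hm))),
      mul_zero] at hne
    exact hne rfl

/-! ## Every coset term vanishes unless `χ'` is a rearrangement of `χ` -/

omit [Fintype F] in
/-- **Torus probes.**  Write `q = s₀ w(τ) P'`; then for every position `a` and unit `x` the element
`s₀ diag(δ^x_{τ a}) s₀⁻¹` stabilises `q` and, if `f_q = 1`, `λ_χ(diag δ^x_{τ a})⁻¹ λ_χ'(diag δ^x_a) = 1`. -/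
theorem probe_eq_one (χ χ' : Fin k → MulChar F ℂ) {q : GL (Fin (k + l)) F ⧸ flagStab F k l}
    (hf : fq χ χ' q = 1) {τ : Equiv.Perm (Fin (k + l))} {s₀ : flagStab F k l}
    (hs : s₀ • ((permGL τ : GL (Fin (k + l)) F) : GL (Fin (k + l)) F ⧸ flagStab F k l) = q)
    (a : Fin (k + l)) (x : Fˣ) :
    ((lam χ ⟨diagGL (Pi.mulSingle (τ a) x), diagGL_mem (Pi.mulSingle (τ a) x)⟩ : ℂˣ) : ℂ)⁻¹ *
      ((lam χ' ⟨diagGL (l := l) (Pi.mulSingle a x), diagGL_mem (Pi.mulSingle a x)⟩ : ℂˣ) : ℂ)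
        = 1 := by
  have hq2 : ((((s₀ : GL (Fin (k + l)) F) * permGL τ : GL (Fin (k + l)) F)) :
      GL (Fin (k + l)) F ⧸ flagStab F k l) = q := hs
  obtain ⟨p₀, hp₀⟩ := QuotientGroup.mk_out_eq_mul (flagStab F k l)
    ((s₀ : GL (Fin (k + l)) F) * permGL τ)
  rw [hq2] at hp₀
  have htP : diagGL (Pi.mulSingle (τ a) x) ∈ flagStab F k l := diagGL_mem _
  have helt : (s₀ : GL (Fin (k + l)) F) * diagGL (Pi.mulSingle (τ a) x) *
      (s₀ : GL (Fin (k + l)) F)⁻¹ ∈ flagStab F k l :=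
    mul_mem (mul_mem s₀.2 htP) (inv_mem s₀.2)
  have hmem' : (p₀ : GL (Fin (k + l)) F)⁻¹ * diagGL (Pi.mulSingle a x) *
      (p₀ : GL (Fin (k + l)) F) ∈ flagStab F k l :=
    mul_mem (mul_mem (inv_mem p₀.2) (diagGL_mem _)) p₀.2
  have hconj : q.out⁻¹ * ((s₀ : GL (Fin (k + l)) F) *
      diagGL (Pi.mulSingle (τ a) x) * (s₀ : GL (Fin (k + l)) F)⁻¹) * q.out =
      (p₀ : GL (Fin (k + l)) F)⁻¹ * diagGL (Pi.mulSingle a x) * (p₀ : GL (Fin (k + l)) F) := by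
    rw [hp₀]
    have h1 : ((s₀ : GL (Fin (k + l)) F) * permGL τ * (p₀ : GL (Fin (k + l)) F))⁻¹ *
        ((s₀ : GL (Fin (k + l)) F) * diagGL (Pi.mulSingle (τ a) x) *
          (s₀ : GL (Fin (k + l)) F)⁻¹) * ((s₀ : GL (Fin (k + l)) F) * permGL τ *
            (p₀ : GL (Fin (k + l)) F)) =
        (p₀ : GL (Fin (k + l)) F)⁻¹ * ((permGL τ)⁻¹ *
          diagGL (Pi.mulSingle (τ a) x) * permGL τ) * (p₀ : GL (Fin (k + l)) F) := by
      group
    rw [h1, conj_diagGL]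
    congr 2
    refine congrArg diagGL (funext fun b => ?_)
    simp only [Pi.mulSingle_apply, EmbeddingLike.apply_eq_iff_eq]
  have hstab : (⟨_, helt⟩ : flagStab F k l) ∈ MulAction.stabilizer (flagStab F k l) q := by
    rw [MulAction.mem_stabilizer_iff]
    refine (smul_eq_self_iff_mem _ ((s₀ : GL (Fin (k + l)) F) *
      diagGL (Pi.mulSingle (τ a) x) * (s₀ : GL (Fin (k + l)) F)⁻¹) q).mpr ?_
    rw [hconj]
    exact hmem'
  have h1 := fq_apply χ χ' q ⟨⟨_, helt⟩, hstab⟩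
  rw [hf, MonoidHom.one_apply] at h1
  have e1 : lam χ (⟨(s₀ : GL (Fin (k + l)) F) * diagGL (Pi.mulSingle (τ a) x) *
      (s₀ : GL (Fin (k + l)) F)⁻¹, helt⟩ : flagStab F k l) = lam χ ⟨_, htP⟩ := by
    have e : (⟨(s₀ : GL (Fin (k + l)) F) * diagGL (Pi.mulSingle (τ a) x) *
        (s₀ : GL (Fin (k + l)) F)⁻¹, helt⟩ : flagStab F k l) = s₀ * ⟨_, htP⟩ * s₀⁻¹ := rfl
    rw [e, map_mul, map_mul, map_inv, mul_comm (lam χ s₀) _, mul_assoc, mul_inv_cancel, mul_one]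
  have e2 : conjHom q ⟨⟨_, helt⟩, hstab⟩ = ⟨_, hmem'⟩ := Subtype.ext hconj
  rw [e2, lam_conj χ' p₀.2 (diagGL_mem _) hmem'] at h1
  have e1' : ((lam χ (((⟨⟨_, helt⟩, hstab⟩ : MulAction.stabilizer (flagStab F k l) q) :
      flagStab F k l)) : ℂˣ) : ℂ) = ((lam χ ⟨_, htP⟩ : ℂˣ) : ℂ) := by
    rw [← e1]
  rw [e1'] at h1
  exact h1.symm

omit [Fintype F] in
/-- **`f_q ≠ 1` for every coset `q`** when all `χ'_i ≠ 1` and `χ'` is not a rearrangement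
`χ ∘ σ` of `χ`. -/
theorem fq_ne_one {χ χ' : Fin k → MulChar F ℂ} (hχ'1 : ∀ i, χ' i ≠ 1)
    (hne : ∀ σ : Equiv.Perm (Fin k), χ' ≠ χ ∘ σ) (q : GL (Fin (k + l)) F ⧸ flagStab F k l) :
    fq χ χ' q ≠ 1 := by
  intro hf
  obtain ⟨τ, s₀, hs⟩ := exists_perm_orbit (F := F) (k := k) (l := l) q.out
  rw [QuotientGroup.out_eq'] at hs
  have hval := probe_eq_one χ χ' hf hs
  -- at `a = c_i`: `τ c_i = c_{i'}` with `χ'_i = χ_{i'}`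
  have hσ : ∀ i : Fin k, ∃ i' : Fin k, τ (Fin.castAdd l i) = Fin.castAdd l i' ∧ χ' i = χ i' := by
    intro i
    by_cases hdc : ∃ i' : Fin k, Fin.castAdd l i' = τ (Fin.castAdd l i)
    · obtain ⟨i', hi'⟩ := hdc
      refine ⟨i', hi'.symm, MulChar.ext fun x => ?_⟩
      have h := hval (Fin.castAdd l i) x
      simp only [← hi'] at h
      rw [lam_diagGL_mulSingle_castAdd, lam_diagGL_mulSingle_castAdd] at h
      have hu : χ i' (x : F) ≠ 0 := by
        rw [← MulChar.coe_toUnitHom]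
        exact Units.ne_zero _
      exact ((inv_mul_eq_one₀ hu).mp h).symm
    · exfalso
      have hd : ∀ i' : Fin k, Fin.castAdd l i' ≠ τ (Fin.castAdd l i) := fun i' h => hdc ⟨i', h⟩
      apply hχ'1 i
      refine MulChar.ext fun x => ?_
      have h := hval (Fin.castAdd l i) x
      rw [lam_diagGL_mulSingle_of_ne χ hd, inv_one, one_mul, lam_diagGL_mulSingle_castAdd] at h
      rw [h, MulChar.one_apply_coe]
  choose σ hσ1 hσ2 using hσ
  have hinj : Function.Injective σ := by
    intro i j hij
    have h : τ (Fin.castAdd l i) = τ (Fin.castAdd l j) := by rw [hσ1, hσ1, hij]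
    exact Fin.castAdd_inj.mp (τ.injective h)
  exact hne (Equiv.ofBijective σ (Finite.injective_iff_bijective.mp hinj)) (funext fun i => hσ2 i)

/-- **Every coset term vanishes.** -/
theorem cosetTerm_eq_zero {χ χ' : Fin k → MulChar F ℂ} (hχ'1 : ∀ i, χ' i ≠ 1)
    (hne : ∀ σ : Equiv.Perm (Fin k), χ' ≠ χ ∘ σ) (q : GL (Fin (k + l)) F ⧸ flagStab F k l) :
    cosetTerm χ χ' q = 0 := by
  rw [cosetTerm_eq_sum_fq]
  exact sum_hom_units_eq_zero _ (fq_ne_one hχ'1 hne q)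

/-! ## Orthogonality and distinctness -/

/-- **`⟨Ψ_χ, Ψ_χ'⟩ = 0`** when all `χ'_i ≠ 1` and `χ'` is not a rearrangement of `χ`. -/
theorem classInner_twChar_twChar {χ χ' : Fin k → MulChar F ℂ} (hχ'1 : ∀ i, χ' i ≠ 1)
    (hne : ∀ σ : Equiv.Perm (Fin k), χ' ≠ χ ∘ σ) :
    classInner (twChar (l := l) χ) (twChar χ') = 0 := by
  have hP : (Fintype.card (flagStab F k l) : ℂ) ≠ 0 := Nat.cast_ne_zero.mpr Fintype.card_ne_zero
  have h := card_mul_classInner_eq_sum (l := l) χ χ'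
  rw [Finset.sum_eq_zero (fun q _ => cosetTerm_eq_zero hχ'1 hne q)] at h
  exact (mul_eq_zero.mp h).resolve_left hP

/-- **Distinctness**: if `χ` has distinct non-trivial entries, all `χ'_i ≠ 1` and `χ'` is not a
rearrangement of `χ`, then `Ψ_χ ≠ Ψ_χ'` (indeed `⟨Ψ_χ,Ψ_χ⟩ = 1 ≠ 0 = ⟨Ψ_χ,Ψ_χ'⟩`). -/
theorem twChar_ne {χ χ' : Fin k → MulChar F ℂ} (hχ : Function.Injective χ) (hχ1 : ∀ i, χ i ≠ 1)
    (hχ'1 : ∀ i, χ' i ≠ 1) (hne : ∀ σ : Equiv.Perm (Fin k), χ' ≠ χ ∘ σ) :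
    twChar (l := l) χ ≠ twChar χ' := by
  intro e
  have h0 := classInner_twChar_twChar (l := l) hχ'1 hne
  rw [← e, classInner_twChar hχ hχ1] at h0
  exact one_ne_zero h0

end FlagTwistOrtho
end Summit.MatrixMultiplication.MatrixMultiplication.Theorems.SubgroupIdentityDesigns.Negative

end
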